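import Summits.BirchSwinnertonDyer.BirchSwinnertonDyer.Theorems.KolyvaginDepthDoorDepthTableLambdaJoin
import Summits.BirchSwinnertonDyer.BirchSwinnertonDyer.Theorems.KolyvaginDepthDoorDepthTableRowKit
import Summits.BirchSwinnertonDyer.BirchSwinnertonDyer.Theorems.Rank2ObservatoryPadicAtlasR3A00
import Summits.BirchSwinnertonDyer.Rank1Residual.Additive.PointCountEulerNat
import HarnessLib

/-!
# Route `KolyvaginDepthDoor` — the λ-join BEYOND the rank-2 table: the crux's clause at a RANK-3 curve
# (depth `ν = 2 = rank − 1`, witness on TWO Kolyvagin primes) from its `p`-adic atlas cell; showcase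
# `5077a1` at `p = 5` (crux `KolyvaginDepthSupply`, stmt-BirchSwinnertonDyer-21765)

Helper file (`--supports stmt-BirchSwinnertonDyer-21765 --as helper`); it closes nothing and BSD is
not proved by it. HONEST FRAMING: per-curve theorems, CONDITIONAL on the seven named facts of
`KolyvaginDepthDoorDepthTableLambdaJoin` (`hA` BCGS 2026 Thm. 1, `hF` Kolyvagin 1991 Thm. 4, `hmod`,
`hHL`, `hBFH`, `hGZK`, `hPRS`), on Kato 17.4 for the newform and on the modular-symbol DATA hypotheses of
the tree's rank-3 `p`-adic atlas (`Rank2ObservatoryPadicAtlasR3A*`, `AtlasCurve3.padicRow`: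
kernel-checked `ord_T L_p = 3`, hence `rank = 3 = corank Sel_{p^∞}` — there the rank input
`3 ≤ rank` is itself a kernel theorem, `three_le_rank_of_mem_atlasR3A00`).

The route is a «rank `≥ 2` DOOR»; its instrument (the depth table) is the rank-2 slice, where the
predicted witness is ONE Kolyvagin prime. The same per-curve supply
(`kolyvaginDepthSupply_clause_of_shaCorank_eq_zero_of_two_le_rank`, rank `≥ 2`) applies verbatim at
rank `3`: `t_p = 0` at a big-image prime forces a depth-minimal non-zero class at depth EXACTLY
`2 = rank − 1`, i.e. on a square-free product `n = ℓℓ′` of TWO Kolyvagin primes — the first typed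
rank-3 instance of the crux's clause, and the shape a rank-3 depth computation would have to find.

* `kolyvaginDepthSupply_clause_of_atlasCell3` — a cell of the rank-3 atlas (+ `ρ̄_{E,p}` onto) gives
  the clause of `KolyvaginDepthSupply` at `W = C.e ⊗ ℚ`, verbatim.
* `exists_depth_two_class_of_atlasCell3` — the same in depth currency: for some admissible `K`, a
  depth-minimal non-zero class at depth exactly `2`, nothing non-zero at depth `≤ 1`,
  `rank E^{(d_K)} < rank E = 3`.
* `C5077a1.hasSurjectiveModNGaloisRep_5` — `ρ̄_{E,5}` onto for `5077a1 = [0,0,1,−7,6]` (`N = 5077`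
  prime, semistable; Mazur witness `a_3 = −3`: `X² + 3X + 3` has no root mod `5`; Serre Prop. 21),
  kernel-decided; `C5077a1.kolyvaginDepthSupply_clause_of_lambda` /
  `C5077a1.exists_depth_two_class_of_lambda` — the showcase at the cell `(5077a1, 5)`.

References: [Kolyvagin1991MathAnn] §2 Thm. 4; [BurungaleEtAl2026] arXiv:2312.09301 Thm. 1;
[SteinWuthrich2013] Thm. 1.1, §3; [MazurTateTeitelbaum1986Invent] §I.10–I.13; [Kato2004Asterisque]
Thm. 17.4; [BalakrishnanMullerStein2015] Thm. 1.7; [CremonaAlgorithms1997] Table 1 (5077a1);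
[Serre1972] §5.4 Prop. 21; [Mazur1978] §6 Prop. 6.3 (1).
-/

set_option linter.dupNamespace false

noncomputable section

open scoped Classical NumberField

namespace Summit.BirchSwinnertonDyer.BirchSwinnertonDyer.Theorems.KolyvaginDepthDoor

open Literature.NumberTheory.EllipticCurves Literature.NumberTheory.EllipticCurves.ModularForms
  WeierstrassCurve CongruenceSubgroup
open Summit.BirchSwinnertonDyer.BirchSwinnertonDyer.Theorems
open Summit.BirchSwinnertonDyer.BirchSwinnertonDyer.Rank2Observatory
open Summit.BirchSwinnertonDyer.BirchSwinnertonDyer.Rank1Residual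
open Summit.BirchSwinnertonDyer.Rank1Residual.Additive

/-! ## §1 A rank-3 atlas cell gives the crux's clause (depth `2`) -/

/-- **The λ-join at rank 3 (cyclotomic certificate ⟹ the crux's clause at the curve).** Named facts
as in `kolyvaginDepthSupply_clause_of_atlasCell`; data: a curve `C` of the rank-3 atlas passing its
kernel test, a cell `c ∈ C.cells` (`p = c.p ≥ 5` good ordinary), `W = C.e ⊗ ℚ`; the atlas binders
(`hPRS`, newform `hf`, Kato 17.4 `hkato`, `hlow : 3 ≤ rank` — a kernel theorem for every curve of
`atlasR3A00`, symbol DATA `D, hD, hint, htab`) and `ρ̄_{E,p}` onto. The row (`AtlasCurve3.padicRow`: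
`rank = 3 = corank Sel_{p^∞}`) gives `t_p = 0`; the per-curve supply at rank `≥ 2` gives the clause,
whose witness has `ν(n) + 1 = rank = 3`. CONDITIONAL on seven named facts, `hkato`, the symbol data;
per-curve; BSD is not proved by it. [cite: SteinWuthrich2013, Thm. 1.1 and §3]
[cite: BurungaleEtAl2026, Thm. 1 (arXiv:2312.09301 §0.1)] [cite: Kolyvagin1991MathAnn, §2 Thm. 4]
[cite: BalakrishnanMullerStein2015, Thm. 1.7] -/
theorem kolyvaginDepthSupply_clause_of_atlasCell3
    (hA : BurungaleEtAl2026_exists_kolyvaginClass_ne_zero)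
    (hF : Kolyvagin1991_selmerCorank_of_kolyvaginClass_ne_zero)
    (hmod : exists_isNewformOf) (hHL : HoffsteinLuo1997_exists_twist_L_one_ne_zero)
    (hBFH : bumpFriedbergHoffstein_exists_heegnerField_split_twist_simpleZero)
    (hGZK : rank_eq_analyticRank_of_analyticRank_le_one) (hPRS : Schneider1985_order_charGenerator)
    {C : AtlasCurve3} (hC : C.check = true) {c : AtlasCell} (hc : c ∈ C.cells) [hp : Fact c.p.Prime]
    (W : WeierstrassCurve ℚ) [W.IsElliptic] [W.IsGloballyMinimal] (hW : W = C.e.baseChange ℚ)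
    {N : ℕ} [NeZero N] {f : CuspForm (Gamma0 N) 2} (hf : IsNewformOf W f)
    (hkato : ∀ (κ : ZpExtension ℚ c.p) (γ : Field.absoluteGaloisGroup ℚ),
      kato_divisibility W c.p (κ := κ) (γ := γ) (f := f))
    (hlow : 3 ≤ C.row.curve.mordellWeilRank) (D : ℚ) (hD : ‖(D : ℚ_[c.p])‖ = 1)
    (hint : ∀ x : ℚ, ‖(ratPlusSymbol f x : ℚ_[c.p])‖ ≤ 1)
    (htab : ∀ u : ℕ, u < c.p ^ (c.n + 1) → ¬ c.p ∣ u →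
      ratPlusSymbol f ((u : ℚ) / (c.p : ℚ) ^ (c.n + 1)) = (c.tabHi.getD u 0 : ℚ) / D ∧
      ratPlusSymbol f ((u : ℚ) / (c.p : ℚ) ^ c.n) = (c.tabLo.getD (u % c.p ^ c.n) 0 : ℚ) / D)
    (hsurj : W.HasSurjectiveModNGaloisRep c.p) :
    ∃ (p : ℕ) (hp : Fact p.Prime), 5 ≤ p ∧ W.HasGoodReductionAtPrime p ∧ ¬ (p : ℤ) ∣
      W.frobeniusTrace p ∧ W.HasSurjectiveModNGaloisRep p ∧ ∃ (K : Type) (_ : Field K) (_ :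
      NumberField K), Literature.NumberTheory.EllipticCurves.IsImaginaryQuadratic K ∧
      NumberField.discr K ≠ -3 ∧ NumberField.discr K ≠ -4 ∧ ¬ ((p : ℤ) ∣ NumberField.discr K) ∧ ¬ (p
      ∣ W.conductorNorm ℤ) ∧ ∃ (_ : NeZero (W.conductorNorm ℤ)),
      Literature.NumberTheory.EllipticCurves.SatisfiesHeegnerHypothesis (W.conductorNorm ℤ) K ∧ ∃
      (Dt : Literature.NumberTheory.EllipticCurves.ModularForms.ModularParametrizationData W
      (W.conductorNorm ℤ)) (β : ℤ) (ι : K →+* ℂ) (n : ℕ) (d :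
      Literature.NumberTheory.EllipticCurves.KolyvaginHeegnerData Dt β ι n) (M : ℕ),
      Literature.NumberTheory.EllipticCurves.KolyvaginDescent.KolSupp
      (Literature.NumberTheory.EllipticCurves.Zhang2014.IsKolyvaginPrime (W.conductorNorm ℤ) W K p)
      n ∧ 1 ≤ M ∧ (M : ℕ∞) ≤ Literature.NumberTheory.EllipticCurves.Zhang2014.levelIndex W p n ∧
      d.kolyvaginClass hp.out M ≠ 0 ∧ (∀ (n' : ℕ) (d' :
      Literature.NumberTheory.EllipticCurves.KolyvaginHeegnerData Dt β ι n') (M' : ℕ),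
      Literature.NumberTheory.EllipticCurves.KolyvaginDescent.KolSupp
      (Literature.NumberTheory.EllipticCurves.Zhang2014.IsKolyvaginPrime (W.conductorNorm ℤ) W K p)
      n' → 1 ≤ M' → (M' : ℕ∞) ≤ Literature.NumberTheory.EllipticCurves.Zhang2014.levelIndex W p n' →
      d'.kolyvaginClass hp.out M' ≠ 0 → n.primeFactors.card ≤ n'.primeFactors.card) ∧
      ((n.primeFactors.card + 1 = W.mordellWeilRank ∧ (W.quadraticTwist (NumberField.discr K :
      ℚ)).mordellWeilRank < W.mordellWeilRank) ∨ (n.primeFactors.card = W.mordellWeilRank ∧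
      (W.quadraticTwist (NumberField.discr K : ℚ)).mordellWeilRank = W.mordellWeilRank + 1)) := by
  subst hW
  have hk : c.check3 C.e = true := AtlasCurve3.cell_check hC hc
  have h5 : 5 ≤ c.p := (AtlasCell.arith_of_check3 hk).2.1
  obtain ⟨hgood, hord⟩ := AtlasCell.isOrdinaryAt_of_check3 hk
  obtain ⟨hr3, -, -, -, hsel⟩ := AtlasCurve3.padicRow hC hc hPRS hf hkato hlow D hD hint htab
  have hbc : C.e.baseChange ℚ = C.row.curve := by
    ext <;> simp [AtlasCurve3.e, Rank3Row.curve, WeierstrassCurve.baseChange]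
  have hr3' : (C.e.baseChange ℚ).mordellWeilRank = 3 := by rw [hbc]; exact hr3
  have hid : (C.e.baseChange ℚ).selmerCorank c.p =
      (C.e.baseChange ℚ).mordellWeilRank + (C.e.baseChange ℚ).shaCorank c.p :=
    (C.e.baseChange ℚ).selmerCorank_eq_mordellWeilRank_add_holds c.p
  have ht : (C.e.baseChange ℚ).shaCorank c.p = 0 := by omega
  exact kolyvaginDepthSupply_clause_of_shaCorank_eq_zero_of_two_le_rank hA hF hmod hHL hBFH hGZK _
    (by omega) c.p h5 hgood hord hsurj ht

/-- **The λ-join at rank 3, depth currency.** Same data; conclusion: for some admissible Heegner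
field `K` (`d_K ∉ {−3,−4}`, `p ∤ d_K N_E`, Heegner hypothesis), a frame and a non-zero
Kolyvagin–Heegner class `c_M(n) ≠ 0` (`1 ≤ M ≤ M(n)`) at depth EXACTLY `ν(n) = 2` — `n = ℓℓ′` a product
of TWO Kolyvagin primes — with NO non-zero class of the system at depth `≤ 1`, and
`rank E^{(d_K)} < rank E` (`= 3`). The rank-3 shape of the depth door's witness.
CONDITIONAL on seven named facts, `hkato`, the symbol data; per-curve; BSD is not proved by it.
[cite: Kolyvagin1991MathAnn, §2 Thm. 4] [cite: BurungaleEtAl2026, Thm. 1 (arXiv:2312.09301 §0.1)]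
[cite: SteinWuthrich2013, Thm. 1.1 and §3] -/
theorem exists_depth_two_class_of_atlasCell3
    (hA : BurungaleEtAl2026_exists_kolyvaginClass_ne_zero)
    (hF : Kolyvagin1991_selmerCorank_of_kolyvaginClass_ne_zero)
    (hmod : exists_isNewformOf) (hHL : HoffsteinLuo1997_exists_twist_L_one_ne_zero)
    (hBFH : bumpFriedbergHoffstein_exists_heegnerField_split_twist_simpleZero)
    (hGZK : rank_eq_analyticRank_of_analyticRank_le_one) (hPRS : Schneider1985_order_charGenerator)
    {C : AtlasCurve3} (hC : C.check = true) {c : AtlasCell} (hc : c ∈ C.cells) [hp : Fact c.p.Prime]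
    (W : WeierstrassCurve ℚ) [W.IsElliptic] [W.IsGloballyMinimal] (hW : W = C.e.baseChange ℚ)
    {N : ℕ} [NeZero N] {f : CuspForm (Gamma0 N) 2} (hf : IsNewformOf W f)
    (hkato : ∀ (κ : ZpExtension ℚ c.p) (γ : Field.absoluteGaloisGroup ℚ),
      kato_divisibility W c.p (κ := κ) (γ := γ) (f := f))
    (hlow : 3 ≤ C.row.curve.mordellWeilRank) (D : ℚ) (hD : ‖(D : ℚ_[c.p])‖ = 1)
    (hint : ∀ x : ℚ, ‖(ratPlusSymbol f x : ℚ_[c.p])‖ ≤ 1)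
    (htab : ∀ u : ℕ, u < c.p ^ (c.n + 1) → ¬ c.p ∣ u →
      ratPlusSymbol f ((u : ℚ) / (c.p : ℚ) ^ (c.n + 1)) = (c.tabHi.getD u 0 : ℚ) / D ∧
      ratPlusSymbol f ((u : ℚ) / (c.p : ℚ) ^ c.n) = (c.tabLo.getD (u % c.p ^ c.n) 0 : ℚ) / D)
    (hsurj : W.HasSurjectiveModNGaloisRep c.p) :
    ∃ (K : Type) (_ : Field K) (_ : NumberField K), IsImaginaryQuadratic K ∧
      NumberField.discr K ≠ -3 ∧ NumberField.discr K ≠ -4 ∧ ¬ ((c.p : ℤ) ∣ NumberField.discr K) ∧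
      ¬ (c.p ∣ W.conductorNorm ℤ) ∧ ∃ (_ : NeZero (W.conductorNorm ℤ)),
      SatisfiesHeegnerHypothesis (W.conductorNorm ℤ) K ∧
      ∃ (Dt : ModularParametrizationData W (W.conductorNorm ℤ)) (β : ℤ) (ι : K →+* ℂ) (n : ℕ)
        (d : KolyvaginHeegnerData Dt β ι n) (M : ℕ),
        KolyvaginDescent.KolSupp (Zhang2014.IsKolyvaginPrime (W.conductorNorm ℤ) W K c.p) n ∧
        1 ≤ M ∧ (M : ℕ∞) ≤ Zhang2014.levelIndex W c.p n ∧ d.kolyvaginClass hp.out M ≠ 0 ∧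
        (∀ (n' : ℕ) (d' : KolyvaginHeegnerData Dt β ι n') (M' : ℕ),
          KolyvaginDescent.KolSupp (Zhang2014.IsKolyvaginPrime (W.conductorNorm ℤ) W K c.p) n' →
          1 ≤ M' → (M' : ℕ∞) ≤ Zhang2014.levelIndex W c.p n' → d'.kolyvaginClass hp.out M' ≠ 0 →
          2 ≤ n'.primeFactors.card) ∧
        n.primeFactors.card = 2 ∧
        (W.quadraticTwist (NumberField.discr K : ℚ)).mordellWeilRank < W.mordellWeilRank := by
  subst hW
  have hk : c.check3 C.e = true := AtlasCurve3.cell_check hC hc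
  have h5 : 5 ≤ c.p := (AtlasCell.arith_of_check3 hk).2.1
  obtain ⟨hgood, hord⟩ := AtlasCell.isOrdinaryAt_of_check3 hk
  obtain ⟨hr3, -, -, -, hsel⟩ := AtlasCurve3.padicRow hC hc hPRS hf hkato hlow D hD hint htab
  have hbc : C.e.baseChange ℚ = C.row.curve := by
    ext <;> simp [AtlasCurve3.e, Rank3Row.curve, WeierstrassCurve.baseChange]
  have hr3' : (C.e.baseChange ℚ).mordellWeilRank = 3 := by rw [hbc]; exact hr3
  have hid : (C.e.baseChange ℚ).selmerCorank c.p =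
      (C.e.baseChange ℚ).mordellWeilRank + (C.e.baseChange ℚ).shaCorank c.p :=
    (C.e.baseChange ℚ).selmerCorank_eq_mordellWeilRank_add_holds c.p
  have ht : (C.e.baseChange ℚ).shaCorank c.p = 0 := by omega
  obtain ⟨K, iF, iN, hK, h3, h4, hpd, hpN, iNZ, hH, Dt, β, ι, n, d, M, hΛ, hM, hMle, hne, hmin, hcard,
    hlt⟩ :=
    exists_heegnerField_minimal_class_of_shaCorank_eq_zero_of_two_le_rank hA hF hmod hHL hBFH hGZK _
      (by omega) c.p h5 hgood hord hsurj ht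
  have hν : n.primeFactors.card = 2 := by omega
  refine ⟨K, iF, iN, hK, h3, h4, hpd, hpN, iNZ, hH, Dt, β, ι, n, d, M, hΛ, hM, hMle, hne, ?_, hν, hlt⟩
  intro n' d' M' hΛ' hM' hM'le hne'
  rw [← hν]
  exact hmin n' d' M' hΛ' hM' hM'le hne'

/-! ## §2 Showcase: `5077a1` (rank 3, `N = 5077`) at `p = 5` -/

namespace C5077a1

/-- `5077a1` is a curve of the rank-3 atlas table `atlasR3A00`. [cite: CremonaAlgorithms1997, Table 1 (5077a1)] -/
theorem mem_atlas : c5077a1 ∈ atlasR3A00 := by simp [atlasR3A00]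

/-- `#Ẽ(𝔽_3) = 7`, `a_3 = −3` for `5077a1 = [0,0,1,−7,6]`, kernel-decided (`ℕ`-arithmetic Euler count).
[cite: CremonaAlgorithms1997, Table 1 (5077a1)] -/
theorem card_3 :
    Nat.card (((⟨0, 0, 1, -7, 6⟩ : WeierstrassCurve ℤ).map (Int.castRingHom (ZMod 3))).toAffine.Point) = 7 := by
  rw [PointCountNat.natCard_point_map_eq (hℓ := ⟨by norm_num⟩) (by norm_num) 0 0 1 (-7) 6
    (by decide +kernel)]
  decide +kernel

/-- **`ρ̄_{E,5}` is surjective for `E = 5077a1`** (unconditional): `N = 5077` is prime, the curve is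
semistable (`gcd(c₄, Δ) = 1`), and `X² − a_3 X + 3 = X² + 3X + 3` has no root modulo `5` (Mazur's
Frobenius certificate ⇒ `E[5]` irreducible; Serre's Prop. 21 ⇒ onto). [cite: Serre1972, §5.4 Prop. 21]
[cite: Mazur1978, §6 Prop. 6.3 (1)] -/
theorem hasSurjectiveModNGaloisRep_5 :
    (c5077a1.e.baseChange ℚ).HasSurjectiveModNGaloisRep (5 : ℕ) := by
  have hn : ∀ t : ZMod 5, t ^ 2 - (((3 : ℕ) : ℤ) + 1 - (7 : ℕ) : ℤ) * t + ((3 : ℕ) : ZMod 5) ≠ 0 := by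
    decide +kernel
  haveI := isElliptic_of_mem_atlasR3A00 mem_atlas
  haveI := isGloballyMinimal_of_mem_atlasR3A00 mem_atlas
  haveI := Fact.mk (by norm_num : Nat.Prime 5)
  haveI := Fact.mk (by norm_num : Nat.Prime 3)
  have hI : integralModelInt (c5077a1.e.baseChange ℚ) = ⟨0, 0, 1, -7, 6⟩ :=
    IntModel.integralModelInt_eq_of_map_eq _ rfl
  exact hasSurjectiveModNGaloisRep_of_intModel_certificate hI
    (by rw [Int.isCoprime_iff_gcd_eq_one]; decide +kernel) 5 3 (by norm_num) (by decide +kernel)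
    (n := 7) card_3 hn

/-- **RANK-3 SHOWCASE `5077a1`, λ-side (`p = 5`): the crux's clause at a rank-3 curve.** For the cell
`c ∈ c5077a1.cells` with `c.p = 5` (`a_5 = −4`, level `n = 1`; `Rank2ObservatoryPadicAtlasR3A00`), GIVEN
the seven named facts, the newform `hf`, Kato 17.4 `hkato` and the symbol DATA, the clause of
`KolyvaginDepthSupply` holds at `W = c5077a1.e ⊗ ℚ = [0,0,1,−7,6]`: `3 ≤ rank` (kernel,
`three_le_rank_of_mem_atlasR3A00`), `ρ̄_{E,5}` onto (`hasSurjectiveModNGaloisRep_5`), minimality, good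
ordinary reduction and the Riemann-sum certificate `ord_T L_5 = 3` being kernel theorems. The witness
has `ν(n) + 1 = 3`. Per-curve; BSD is not proved by it. [cite: SteinWuthrich2013, Thm. 1.1 and §3]
[cite: BurungaleEtAl2026, Thm. 1 (arXiv:2312.09301 §0.1)] [cite: Kolyvagin1991MathAnn, §2 Thm. 4]
[cite: CremonaAlgorithms1997, Table 1 (5077a1)] -/
theorem kolyvaginDepthSupply_clause_of_lambda
    (hA : BurungaleEtAl2026_exists_kolyvaginClass_ne_zero)
    (hF : Kolyvagin1991_selmerCorank_of_kolyvaginClass_ne_zero)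
    (hmod : exists_isNewformOf) (hHL : HoffsteinLuo1997_exists_twist_L_one_ne_zero)
    (hBFH : bumpFriedbergHoffstein_exists_heegnerField_split_twist_simpleZero)
    (hGZK : rank_eq_analyticRank_of_analyticRank_le_one) (hPRS : Schneider1985_order_charGenerator)
    {c : AtlasCell} (hc : c ∈ c5077a1.cells) (hc5 : c.p = 5) :
    haveI := isElliptic_of_mem_atlasR3A00 mem_atlas;
    haveI := isGloballyMinimal_of_mem_atlasR3A00 mem_atlas;
    ∀ {N : ℕ} [NeZero N] {f : CuspForm (Gamma0 N) 2} (_hf : IsNewformOf (c5077a1.e.baseChange ℚ) f)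
    (_hkato : ∀ (κ : ZpExtension ℚ 5) (γ : Field.absoluteGaloisGroup ℚ),
      kato_divisibility (c5077a1.e.baseChange ℚ) 5 (κ := κ) (γ := γ) (f := f))
    (D : ℚ) (_hD : ‖(D : ℚ_[5])‖ = 1) (_hint : ∀ x : ℚ, ‖(ratPlusSymbol f x : ℚ_[5])‖ ≤ 1)
    (_htab : ∀ u : ℕ, u < 5 ^ (c.n + 1) → ¬ 5 ∣ u →
      ratPlusSymbol f ((u : ℚ) / (5 : ℚ) ^ (c.n + 1)) = (c.tabHi.getD u 0 : ℚ) / D ∧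
      ratPlusSymbol f ((u : ℚ) / (5 : ℚ) ^ c.n) = (c.tabLo.getD (u % 5 ^ c.n) 0 : ℚ) / D),
    ∃ (p : ℕ) (hp : Fact p.Prime), 5 ≤ p ∧ (c5077a1.e.baseChange ℚ).HasGoodReductionAtPrime p ∧ ¬ (p : ℤ) ∣
      (c5077a1.e.baseChange ℚ).frobeniusTrace p ∧ (c5077a1.e.baseChange ℚ).HasSurjectiveModNGaloisRep p ∧ ∃ (K : Type) (_ : Field K) (_ :
      NumberField K), Literature.NumberTheory.EllipticCurves.IsImaginaryQuadratic K ∧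
      NumberField.discr K ≠ -3 ∧ NumberField.discr K ≠ -4 ∧ ¬ ((p : ℤ) ∣ NumberField.discr K) ∧ ¬ (p
      ∣ (c5077a1.e.baseChange ℚ).conductorNorm ℤ) ∧ ∃ (_ : NeZero ((c5077a1.e.baseChange ℚ).conductorNorm ℤ)),
      Literature.NumberTheory.EllipticCurves.SatisfiesHeegnerHypothesis ((c5077a1.e.baseChange ℚ).conductorNorm ℤ) K ∧ ∃
      (Dt : Literature.NumberTheory.EllipticCurves.ModularForms.ModularParametrizationData (c5077a1.e.baseChange ℚ)
      ((c5077a1.e.baseChange ℚ).conductorNorm ℤ)) (β : ℤ) (ι : K →+* ℂ) (n : ℕ) (d :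
      Literature.NumberTheory.EllipticCurves.KolyvaginHeegnerData Dt β ι n) (M : ℕ),
      Literature.NumberTheory.EllipticCurves.KolyvaginDescent.KolSupp
      (Literature.NumberTheory.EllipticCurves.Zhang2014.IsKolyvaginPrime ((c5077a1.e.baseChange ℚ).conductorNorm ℤ) (c5077a1.e.baseChange ℚ) K p)
      n ∧ 1 ≤ M ∧ (M : ℕ∞) ≤ Literature.NumberTheory.EllipticCurves.Zhang2014.levelIndex (c5077a1.e.baseChange ℚ) p n ∧
      d.kolyvaginClass hp.out M ≠ 0 ∧ (∀ (n' : ℕ) (d' :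
      Literature.NumberTheory.EllipticCurves.KolyvaginHeegnerData Dt β ι n') (M' : ℕ),
      Literature.NumberTheory.EllipticCurves.KolyvaginDescent.KolSupp
      (Literature.NumberTheory.EllipticCurves.Zhang2014.IsKolyvaginPrime ((c5077a1.e.baseChange ℚ).conductorNorm ℤ) (c5077a1.e.baseChange ℚ) K p)
      n' → 1 ≤ M' → (M' : ℕ∞) ≤ Literature.NumberTheory.EllipticCurves.Zhang2014.levelIndex (c5077a1.e.baseChange ℚ) p n' →
      d'.kolyvaginClass hp.out M' ≠ 0 → n.primeFactors.card ≤ n'.primeFactors.card) ∧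
      ((n.primeFactors.card + 1 = (c5077a1.e.baseChange ℚ).mordellWeilRank ∧ ((c5077a1.e.baseChange ℚ).quadraticTwist (NumberField.discr K :
      ℚ)).mordellWeilRank < (c5077a1.e.baseChange ℚ).mordellWeilRank) ∨ (n.primeFactors.card = (c5077a1.e.baseChange ℚ).mordellWeilRank ∧
      ((c5077a1.e.baseChange ℚ).quadraticTwist (NumberField.discr K : ℚ)).mordellWeilRank = (c5077a1.e.baseChange ℚ).mordellWeilRank + 1)) := by
  haveI := isElliptic_of_mem_atlasR3A00 mem_atlas
  haveI := isGloballyMinimal_of_mem_atlasR3A00 mem_atlas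
  intro N _ f hf hkato D hD hint htab
  have hC : c5077a1.check = true := (AtlasCurve3.check_of_all atlasR3A00_check mem_atlas).1
  obtain ⟨p', ap, n, A, tHi, tLo, H, L⟩ := c
  dsimp only at hc5
  subst hc5
  exact kolyvaginDepthSupply_clause_of_atlasCell3 hA hF hmod hHL hBFH hGZK hPRS hC hc
    (hp := ⟨by norm_num⟩) _ rfl hf hkato (three_le_rank_of_mem_atlasR3A00 mem_atlas) D hD hint htab
    hasSurjectiveModNGaloisRep_5

/-- **RANK-3 SHOWCASE `5077a1`, depth currency**: from the same cell, for some admissible Heegner field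
`K` a depth-minimal non-zero class at depth EXACTLY `2` (on `n = ℓℓ′`, two Kolyvagin primes for
`(5077a1, K, 5)`), nothing non-zero at depth `≤ 1`, `rank E^{(d_K)} < 3`. Per-curve; BSD is not proved
by it. [cite: Kolyvagin1991MathAnn, §2 Thm. 4] [cite: BurungaleEtAl2026, Thm. 1 (arXiv:2312.09301 §0.1)] -/
theorem exists_depth_two_class_of_lambda
    (hA : BurungaleEtAl2026_exists_kolyvaginClass_ne_zero)
    (hF : Kolyvagin1991_selmerCorank_of_kolyvaginClass_ne_zero)
    (hmod : exists_isNewformOf) (hHL : HoffsteinLuo1997_exists_twist_L_one_ne_zero)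
    (hBFH : bumpFriedbergHoffstein_exists_heegnerField_split_twist_simpleZero)
    (hGZK : rank_eq_analyticRank_of_analyticRank_le_one) (hPRS : Schneider1985_order_charGenerator)
    {c : AtlasCell} (hc : c ∈ c5077a1.cells) (hc5 : c.p = 5) :
    haveI := isElliptic_of_mem_atlasR3A00 mem_atlas;
    haveI := isGloballyMinimal_of_mem_atlasR3A00 mem_atlas;
    ∀ {N : ℕ} [NeZero N] {f : CuspForm (Gamma0 N) 2} (_hf : IsNewformOf (c5077a1.e.baseChange ℚ) f)
    (_hkato : ∀ (κ : ZpExtension ℚ 5) (γ : Field.absoluteGaloisGroup ℚ),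
      kato_divisibility (c5077a1.e.baseChange ℚ) 5 (κ := κ) (γ := γ) (f := f))
    (D : ℚ) (_hD : ‖(D : ℚ_[5])‖ = 1) (_hint : ∀ x : ℚ, ‖(ratPlusSymbol f x : ℚ_[5])‖ ≤ 1)
    (_htab : ∀ u : ℕ, u < 5 ^ (c.n + 1) → ¬ 5 ∣ u →
      ratPlusSymbol f ((u : ℚ) / (5 : ℚ) ^ (c.n + 1)) = (c.tabHi.getD u 0 : ℚ) / D ∧
      ratPlusSymbol f ((u : ℚ) / (5 : ℚ) ^ c.n) = (c.tabLo.getD (u % 5 ^ c.n) 0 : ℚ) / D),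
    ∃ (K : Type) (_ : Field K) (_ : NumberField K), IsImaginaryQuadratic K ∧
      NumberField.discr K ≠ -3 ∧ NumberField.discr K ≠ -4 ∧ ¬ ((5 : ℤ) ∣ NumberField.discr K) ∧
      ¬ (5 ∣ (c5077a1.e.baseChange ℚ).conductorNorm ℤ) ∧ ∃ (_ : NeZero ((c5077a1.e.baseChange ℚ).conductorNorm ℤ)),
      SatisfiesHeegnerHypothesis ((c5077a1.e.baseChange ℚ).conductorNorm ℤ) K ∧
      ∃ (Dt : ModularParametrizationData (c5077a1.e.baseChange ℚ) ((c5077a1.e.baseChange ℚ).conductorNorm ℤ)) (β : ℤ) (ι : K →+* ℂ) (n : ℕ)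
        (d : KolyvaginHeegnerData Dt β ι n) (M : ℕ),
        KolyvaginDescent.KolSupp (Zhang2014.IsKolyvaginPrime ((c5077a1.e.baseChange ℚ).conductorNorm ℤ) (c5077a1.e.baseChange ℚ) K 5) n ∧
        1 ≤ M ∧ (M : ℕ∞) ≤ Zhang2014.levelIndex (c5077a1.e.baseChange ℚ) 5 n ∧ d.kolyvaginClass (show Nat.Prime 5 by norm_num) M ≠ 0 ∧
        (∀ (n' : ℕ) (d' : KolyvaginHeegnerData Dt β ι n') (M' : ℕ),
          KolyvaginDescent.KolSupp (Zhang2014.IsKolyvaginPrime ((c5077a1.e.baseChange ℚ).conductorNorm ℤ) (c5077a1.e.baseChange ℚ) K 5) n' →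
          1 ≤ M' → (M' : ℕ∞) ≤ Zhang2014.levelIndex (c5077a1.e.baseChange ℚ) 5 n' → d'.kolyvaginClass (show Nat.Prime 5 by norm_num) M' ≠ 0 →
          2 ≤ n'.primeFactors.card) ∧
        n.primeFactors.card = 2 ∧
        ((c5077a1.e.baseChange ℚ).quadraticTwist (NumberField.discr K : ℚ)).mordellWeilRank < (c5077a1.e.baseChange ℚ).mordellWeilRank := by
  haveI := isElliptic_of_mem_atlasR3A00 mem_atlas
  haveI := isGloballyMinimal_of_mem_atlasR3A00 mem_atlas
  intro N _ f hf hkato D hD hint htab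
  have hC : c5077a1.check = true := (AtlasCurve3.check_of_all atlasR3A00_check mem_atlas).1
  obtain ⟨p', ap, n, A, tHi, tLo, H, L⟩ := c
  dsimp only at hc5
  subst hc5
  exact exists_depth_two_class_of_atlasCell3 hA hF hmod hHL hBFH hGZK hPRS hC hc (hp := ⟨by norm_num⟩)
    _ rfl hf hkato (three_le_rank_of_mem_atlasR3A00 mem_atlas) D hD hint htab
    hasSurjectiveModNGaloisRep_5

end C5077a1

end Summit.BirchSwinnertonDyer.BirchSwinnertonDyer.Theorems.KolyvaginDepthDoor

end
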